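import Summits.ResolutionOfSingularities.ResolutionOfSingularities.Theorems.EquisingularLiftEquisingularLiftNatEmbeddedCurveLiftOfFact
import Summits.ResolutionOfSingularities.ResolutionOfSingularities.Theorems.EquisingularLiftEquisingularLiftNatLocallyRegularSequence
import HarnessLib

/-!
# [OURS · L1 W4.5(b) · EL♮(3) · (T-k)] P0 CLOSED: `EmbeddedLiftFact → EmbeddedCurveLiftFact`

Crux chain w45b (cell `res-hironaka`, slot W4.5(b)), working crux **EL♮** = stmt-ResolutionOfSingularities-20038, child **EL♮(3)** =
stmt-ResolutionOfSingularities-20148; the NEED-FACT stub `stub_elnat_embeddedCurveLiftFact : EmbeddedCurveLiftFact` (…NatTowerRoundFourDefs, p594791).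
res-type-027 g16, (T-k) census `Cruxes/EquisingularLiftNatThree/Lines/TK-CENSUS-res-type-027.md`. The composition of
* P0 `embeddedCurveLiftFact_of_embeddedLiftFact_of_lci` (…NatEmbeddedCurveLiftOfFact, p596306: (F) + (P2) ⊢ (T-k), with P1/P3/P4/P5 inside), and
* P2 `locallyRegularSequence_of_isRegular` (…NatLocallyRegularSequence, p596496, res-D-pv-035 g9 over `exists_away_isWeaklyRegular_of_isRsopPart`,
  p596109: regular-in-regular is a local complete intersection).
So the tower's hypothesis-residue (T-k) IS the general embedded-lifting statement (F) `EmbeddedLiftFact` (…NatEmbeddedLiftFactDefs, p595850 —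
Hartshorne 2010 Thm. 22.3 with a general proper flat ambient; OURS hypothesis), up to kernel-checked plumbing; (F) itself is the infinitesimal
NEED-FACT (Hartshorne 2010 Thm. 6.2 (b) / 9.2 (b)) + F-88 `FormalGeometry.GrothendieckExistence` + J3 `flat_of_forall_flat_quotient_pow` (p596343) +
assembly (next file). HONEST FRAMING: OURS; NOT a statement of H. Hironaka's 2017 manuscript; AI-written, gate-checked, weaker than expert review.
No `sorry`; standard axioms; DEF-FREE. `--supports stmt-ResolutionOfSingularities-20148 --as helper`.
-/

set_option linter.dupNamespace false

noncomputable section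

open CategoryTheory AlgebraicGeometry

namespace Summit.ResolutionOfSingularities.ResolutionOfSingularities.Cruxes.EquisingularLiftNat.Sections

/-- **P0 closed: `EmbeddedLiftFact → EmbeddedCurveLiftFact`.** The registered hypothesis-residue (T-k) of the NINETEENTH/TWENTIETH skeletons
follows from the general embedded-lifting statement (F) alone: P2 (lci from regular-in-regular) is res-D-pv-035's
`locallyRegularSequence_of_isRegular`. [OURS · L1 W4.5b · (T-k) plumbing] toward `stub_elnat_embeddedCurveLiftFact` /
`stub_elnat_defTowerSixPointResolution` / `stub_elnat_defNoseTowerResolution` (stmt-ResolutionOfSingularities-20148); NOT a statement of the manuscript. -/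
theorem embeddedCurveLiftFact_of_embeddedLiftFact (hF : EmbeddedLiftFact) : EmbeddedCurveLiftFact :=
  embeddedCurveLiftFact_of_embeddedLiftFact_of_lci hF fun _ _ _ i _ hZ hE => locallyRegularSequence_of_isRegular i hZ hE

/-- The same, pointed at the registered stub's name: **`stub_elnat_embeddedCurveLiftFact` holds under (F)**. [OURS · index] -/
theorem stub_elnat_embeddedCurveLiftFact_of_embeddedLiftFact (hF : EmbeddedLiftFact) : EmbeddedCurveLiftFact :=
  embeddedCurveLiftFact_of_embeddedLiftFact hF

end Summit.ResolutionOfSingularities.ResolutionOfSingularities.Cruxes.EquisingularLiftNat.Sections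

end
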